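import Literature.AlgebraicGeometry.Motives.AbelianVarietyIdentityComponent
import HarnessLib

/-!
# Prym varieties: the identity component of the kernel of a homomorphism of abelian varieties

For a finite cover `f : C → C'` of smooth projective curves the **Prym variety** of `f` is the
abelian subvariety
`P(f) = (Ker Nm_f)⁰ ⊆ J(C)` of the Jacobian of `C`, the connected component of the origin of the
kernel of the norm map `Nm_f : J(C) → J(C')` (with its reduced structure), equivalently the
complementary abelian subvariety of `f^* J(C')` in `J(C)` with respect to the canonical principal
polarization (Lange–Rodríguez, *Decomposition of Jacobians by Prym Varieties*, §3.2.1, definition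
and eq. (3.5); Lange, *Abelian Varieties over the Complex Numbers*, §5.3.2; the notion goes back to
Mumford, *Prym varieties I* (1974), where `f` is an étale double cover and `P = (Ker Nm)⁰` carries
half the restricted polarization). In this generality — arbitrary finite covers, in particular the
non-Galois intermediate covers `C̃/H → C̃/N` of a Galois cover `C̃ → C̃/G` on which Hecke
double-coset correspondences act — the Prym variety `P(f) = (Ker Nm_f)⁰` is the object decomposing
Jacobians with group action (Lange–Rodríguez, Ch. 3; Carocca–Lange–Rodríguez–Rojas 2009).

The construction is performed here for an **arbitrary homomorphism `φ : X → Y` of abelian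
varieties** (`Literature.AlgebraicGeometry.Motives.AbelianVariety`) over an algebraically closed
field `K` (the consumers work over `ℂ`); the Prym variety of a cover `f : C → C'` is the case
`φ = Nm_f = 𝒥.pushforward 𝒥' f`, the norm map of `Motives/Jacobian` (Jacobians `𝒥 : Jacobian C`
characterised by the Albanese property of the difference map), and that specialisation —
`PrymVariety.ofCover 𝒥 𝒥' f` with the deck-transformation action and `dim J(C') + dim P(f) = dim J(C)`
— is the follow-up file `Motives/PrymVarietyOfCover`:

* `AbelianVariety.kerComponentCarrier φ : Closeds X` — the underlying closed subset of
  `(Ker φ)⁰`: the largest irreducible subset of the fibre `φ⁻¹(e)` containing the origin (it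
  exists by Zorn and is unique — `subset_kerComponentCarrier`: every irreducible subset of `φ⁻¹(e)`
  through `e` lies in it — by `Motives/AbelianVarietyIdentityComponent`; `φ⁻¹(e)` is a finite union
  of its translates, `kerSet_subset_iUnion_translation_kerComponentCarrier`), and **it is the
  connected component of the origin in `φ⁻¹(e)`** (`connectedComponentIn_kerSet_origin`: translates
  of `(Ker φ)⁰` by `K`-points of the kernel either equal it or miss it,
  `image_translation_kerComponentCarrier_of_nonempty`, so `(Ker φ)⁰` is open and closed in
  `φ⁻¹(e)`; cf. Görtz–Wedhorn II, Def./Prop. 27.12, Lemma 27.13: the identity component of a group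
  scheme locally of finite type over a field is irreducible);
* `AbelianVariety.kerComponent φ : AbelianVariety K` — **`(Ker φ)⁰_red`, the identity component of
  the kernel with its reduced structure, as an abelian variety** (the abelian subvariety
  `Motives/AbelianVarietyKernelComponent.redSub` on that closed subset: Mumford, *Abelian Varieties*,
  §19 p. 173; Milne 1986, §12, proof of Prop. 12.1), with its inclusion
  `AbelianVariety.kerComponentι φ : kerComponent φ ⟶ X`, a homomorphism and a closed immersion with
  image `kerComponentCarrier φ`, killed by `φ` (`kerComponentι_comp : kerComponentι φ ≫ φ = 0`);
* the **universal property among abelian varieties** (`AbelianVariety.kerComponentLift`,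
  `kerComponentLift_ι`, `kerComponentLift_unique`): a homomorphism `h : Z → X` from an abelian
  variety with `h ≫ φ = 0` factors uniquely through `(Ker φ)⁰_red` (its image is irreducible, contains
  `e` and lies in `φ⁻¹(e)`, hence in the identity component; `Z` is reduced); in particular
  (`AbelianVariety.kerComponentRestrict`) an endomorphism `u` of `X` with `u ≫ φ = φ ≫ v` for some
  endomorphism `v` of `Y` restricts to an endomorphism of `(Ker φ)⁰_red` — this is how correspondences
  commuting with the norm (e.g. Hecke operators of a Galois cover on an intermediate Jacobian) act on
  a Prym variety;
* the **dimension formula** `AbelianVariety.dim_eq_dim_add_dim_kerComponent`: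
  `dim X = dim Y + dim (Ker φ)⁰_red` for `φ` surjective (every chain of specialisations in `φ⁻¹(e)`
  lies in a translate of `(Ker φ)⁰`, `topologicalKrullDim_kerSet_le`, so `dim Ker φ = dim (Ker φ)⁰`,
  combined with `dim X = dim Y + dim Ker φ` of `Motives/AbelianVarietyKernelDimension`);
* `PrymVariety Nm := AbelianVariety.kerComponent Nm` for a homomorphism `Nm : J ⟶ J'` ("the norm map
  of the cover"), with `PrymVariety.incl`, `PrymVariety.incl_comp_norm`,
  `PrymVariety.range_toSchemeHom_incl_eq_connectedComponentIn` (`P = Ker(Nm)⁰` as a subset of `J`),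
  `PrymVariety.lift`, `PrymVariety.restrict`, `PrymVariety.dim_add_dim`/`dim_eq`
  (`dim P = dim J − dim J'` for a surjective norm: Lange–Rodríguez (3.6) `dim P(f) = g̃ − g` granted
  `dim J(C) = g(C)`) — the Prym variety `P(f) = (Ker Nm_f)⁰` of Lange–Rodríguez (3.5) once
  `Nm = Nm_f`.

Scope and omissions (stated, not hidden): (1) `K` is algebraically closed, because the abelian
subvariety on an irreducible closed subgroup (`redSub`) is built in this tree only over `K = K̄`
(products of integral `K`-schemes must be integral); (2) the input is the norm homomorphism, not the
cover `f` itself — for a cover take `Nm := 𝒥.pushforward 𝒥' f` (`Motives/Jacobian`,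
`Motives/PrymVarietyOfCover`); the pull-back `f^*` (with `Nm_f ∘ f^* = deg f`), the surjectivity of
`Nm_f` and `dim J(C) = g(C)` over a general field are not in the tree (`Motives/Jacobian`,
"Deliberately not here"; `dim J = g` over `ℂ` is the named fact
`two_mul_dim_eq_finrank_bettiCohomology` there);
(3) the induced polarization `Θ_{P(f)} := Θ̃|_{P(f)}` (Lange–Rodríguez §3.2.2) is not defined here:
the tree has no polarizations of abelian varieties (`Motives/AbelianVariety`, "Deferred");
realization-level restrictions of a class along `PrymVariety.incl` are one-liners for the consumer
(e.g. `complexBetti.map`), deliberately kept out of this file's import cone.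

Everything in this file is proved; no named facts are introduced.

Design: `PrymVariety` is capitalised as the name of the requested notion although it is a term of
`AbelianVariety K` (as Mathlib's `Spec R : Scheme`); the inclusion is called `PrymVariety.incl`
because `ι` is a token under `open scoped MonObj` (Mathlib's notation for the inverse of a group
object), which every abelian-variety file opens. Scheme-level maps are typed with `redSubOver`
(the `rfl`-unfolding of `(kerComponent φ).X`, `kerComponent_X`) so that Mathlib's instances on
`Scheme.IdealSheafData.subschemeι` are found, as in `Motives/AbelianVarietyImage`.

Mathlib searched (pin): Mathlib has group schemes (`GrpObj`, `Mathlib/AlgebraicGeometry/Group/Abelian`)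
but no abelian (sub)varieties, identity components, Jacobians or Prym varieties (searched `Prym`,
`Jacobian`, `identityComponent`, `connectedComponent` under `Mathlib/AlgebraicGeometry`: no hits);
in this tree `Motives/Jacobian` (`Jacobian`, `Jacobian.pushforward` = `Nm_f`) is the input for covers.
In this tree (used): `redSub`/`redSubHom`/`redSubι`/`redSubOne`/`redSubMul_ι`/`redSubOne_ι`/
`ker_redSubι_le_ker`/`range_redSubι_left`/`kerSet`/`isClosed_kerSet`/`origin_mem_kerSet`/
`comp_eq_one_of_apply_mem`/`redSubι_comp_eq_one`/`range_divMor_subset_of_maximal`/`dim_redSub_lt`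
(`Motives/AbelianVarietyKernelComponent`), `exists_maximal_irreducible_origin_mem`/
`subset_of_isPreirreducible_of_origin_mem`/`subset_image_translation_of_isPreirreducible`/
`exists_finite_subset_iUnion_translation` (`Motives/AbelianVarietyIdentityComponent`),
`dim_eq_dim_add_topologicalKrullDim_ker` (`Motives/AbelianVarietyKernelDimension`),
`translation`/`pointOfClosed` (`Motives/AbelianVarietyTranslation`),
`Literature.Topology.topologicalKrullDim_eq_krullDim`/`quasiSober_of_isClosed`
(`Topology/KrullDimensionDrop`); Mathlib `IsHomeomorph.topologicalKrullDim_eq`,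
`IsInducing.topologicalKrullDim_le`, `IsEmbedding.toHomeomorph`, `Homeomorph.setCongr`,
`IsInducing.specializes_iff`, `subtype_specializes_iff`, `LTSeries.mk`, `IsClosedImmersion.lift`,
`Grp.homMk''` (used).

## References

* H. Lange, R. E. Rodríguez, *Decomposition of Jacobians by Prym Varieties*, Lecture Notes in
  Mathematics 2310, Springer (2022), §3.2.1 (definition of `P(f)`, eq. (3.5) `P(f) = Ker(Nm_f)⁰`,
  eq. (3.6) `dim P(f) = g̃ − g`), §3.2.2 (the polarization `Θ_{P(f)}`); Notations p. xi (`B⁰`).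
  Held: `book:lange2022-decomposition-jacobians-by-prym-varieties` (PDF pp. 14, 55–56).
  [LangeRodriguez2022]
* H. Lange, *Abelian Varieties over the Complex Numbers. A Graduate Course*, Grundlehren Text
  Editions, Springer (2023), §5.3.2 "Definition of a Prym Variety" (pp. 277–278). Held (under the
  store key `book:lange1992-complex-abelian-varieties`, PDF pp. 263–264). [Lange2023AbelianVarietiesC]
* D. Mumford, *Prym varieties I*, in: Contributions to Analysis, Academic Press (1974), 325–350.
  [Mumford1974Prym]
* D. Mumford, *Abelian Varieties*, TIFR Studies in Mathematics 5, OUP (1970), §19 (p. 173: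
  connected components of closed subgroups). [MumfordAV1970]
* J. S. Milne, *Abelian Varieties*, in: Cornell–Silverman (eds.), *Arithmetic Geometry*, Springer
  (1986), §12, proof of Prop. 12.1. [Milne1986AbelianVarieties]
* U. Görtz, T. Wedhorn, *Algebraic Geometry II: Cohomology of Schemes*, Springer Spektrum (2023),
  Def./Prop. 27.12 and Lemma 27.13 (p. 608: the identity component `G⁰`, irreducibility of the
  components, `G` equidimensional), Prop. 27.176 (dimension formula). Held:
  `book:gortz2023-algebraic-geometry-ii-cohomology-schemes-with-examples` (PDF pp. 802–803).
  [GortzWedhorn2023]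
-/

universe u

open CategoryTheory CategoryTheory.Limits AlgebraicGeometry MonoidalCategory CartesianMonoidalCategory
open TopologicalSpace Topology

noncomputable section

namespace Literature.AlgebraicGeometry.Motives

open scoped MonObj
open Scheme.IdealSheafData

namespace AbelianVariety

variable {K : Type u} [Field K]

/-! ### `K`-points of the kernel set -/

section KerSetPoints

variable {X Y : AbelianVariety K} (φ : X ⟶ Y)

/-- A `K`-point of `X` lies in the kernel set `φ⁻¹(e)` iff it is killed by `φ`. [folklore] -/
theorem left_closedPoint_mem_kerSet_iff (P : X.Points K) :
    P.left (IsLocalRing.closedPoint K) ∈ kerSet φ ↔ P ≫ φ.hom.hom.hom = 1 := by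
  refine ⟨comp_eq_one_of_apply_mem φ P, fun h => ?_⟩
  rw [mem_kerSet_iff]
  change (P.left ≫ Hom.toSchemeHom φ) (IsLocalRing.closedPoint K) = origin Y
  have e : P.left ≫ Hom.toSchemeHom φ = (P ≫ φ.hom.hom.hom).left := rfl
  rw [e, h, one_left]
  change (unitPt Y) ((specOver K K).hom (IsLocalRing.closedPoint K)) = origin Y
  rw [eq_specPt K ((specOver K K).hom (IsLocalRing.closedPoint K))]

/-- The `K`-points of the kernel set are closed under products. [folklore] -/
theorem mul_left_closedPoint_mem_kerSet (P Q : X.Points K)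
    (hP : P.left (IsLocalRing.closedPoint K) ∈ kerSet φ)
    (hQ : Q.left (IsLocalRing.closedPoint K) ∈ kerSet φ) :
    (P * Q).left (IsLocalRing.closedPoint K) ∈ kerSet φ := by
  rw [left_closedPoint_mem_kerSet_iff] at hP hQ ⊢
  rw [MonObj.mul_comp, hP, hQ, mul_one]

/-- The `K`-points of the kernel set are closed under inverses. [folklore] -/
theorem inv_left_closedPoint_mem_kerSet (P : X.Points K)
    (hP : P.left (IsLocalRing.closedPoint K) ∈ kerSet φ) :
    P⁻¹.left (IsLocalRing.closedPoint K) ∈ kerSet φ := by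
  rw [left_closedPoint_mem_kerSet_iff] at hP ⊢
  rw [GrpObj.inv_comp, hP, inv_one]

end KerSetPoints

/-! ### The identity component of the kernel: the underlying closed subset -/

section KerComponentCarrier

variable {X Y : AbelianVariety K} (φ : X ⟶ Y)

/-- There is a closed irreducible subset of the kernel set `φ⁻¹(e)` containing the origin and maximal
among the irreducible subsets of `φ⁻¹(e)` (Zorn). [folklore] -/
theorem exists_kerComponentCarrier :
    ∃ C : Closeds X.X.left, IsIrreducible (C : Set X.X.left) ∧ origin X ∈ C ∧
      (C : Set X.X.left) ⊆ kerSet φ ∧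
      ∀ Z : Set X.X.left, IsPreirreducible Z → (C : Set X.X.left) ⊆ Z → Z ⊆ kerSet φ → Z = C :=
  exists_maximal_irreducible_origin_mem (isClosed_kerSet φ) (origin_mem_kerSet φ)

/-- **The underlying closed subset of the identity component `(Ker φ)⁰` of the kernel** of a
homomorphism `φ : X → Y` of abelian varieties: a maximal irreducible subset of the fibre `φ⁻¹(e)`
containing the origin (unique, `subset_kerComponentCarrier`, and over `K = K̄` equal to the connected
component of the origin in `φ⁻¹(e)`, `connectedComponentIn_kerSet_origin` — "`B⁰` = the connected
component of `B` containing `0`", Lange–Rodríguez, Notations p. xi; Görtz–Wedhorn II, Def. 27.12).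
[folklore] -/
def kerComponentCarrier : Closeds X.X.left := (exists_kerComponentCarrier φ).choose

/-- `(Ker φ)⁰` is irreducible. [folklore] -/
theorem isIrreducible_kerComponentCarrier : IsIrreducible (kerComponentCarrier φ : Set X.X.left) :=
  (exists_kerComponentCarrier φ).choose_spec.1

/-- `(Ker φ)⁰` contains the origin. [folklore] -/
theorem origin_mem_kerComponentCarrier : origin X ∈ kerComponentCarrier φ :=
  (exists_kerComponentCarrier φ).choose_spec.2.1

/-- `(Ker φ)⁰ ⊆ φ⁻¹(e)`. [folklore] -/
theorem kerComponentCarrier_subset_kerSet : (kerComponentCarrier φ : Set X.X.left) ⊆ kerSet φ :=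
  (exists_kerComponentCarrier φ).choose_spec.2.2.1

/-- `(Ker φ)⁰` is maximal among the irreducible subsets of `φ⁻¹(e)`. [folklore] -/
theorem kerComponentCarrier_maximal (Z : Set X.X.left) (hZ : IsPreirreducible Z)
    (hCZ : (kerComponentCarrier φ : Set X.X.left) ⊆ Z) (hZN : Z ⊆ kerSet φ) :
    Z = kerComponentCarrier φ :=
  (exists_kerComponentCarrier φ).choose_spec.2.2.2 Z hZ hCZ hZN

/-- `φ` maps `(Ker φ)⁰` to the origin. [folklore] -/
theorem toSchemeHom_apply_of_mem_kerComponentCarrier {x : X.X.left} (hx : x ∈ kerComponentCarrier φ) :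
    Hom.toSchemeHom φ x = origin Y :=
  (mem_kerSet_iff φ).1 (kerComponentCarrier_subset_kerSet φ hx)

variable [IsAlgClosed K]

/-- **Uniqueness of the identity component**: every irreducible subset of `φ⁻¹(e)` containing the
origin lies in `(Ker φ)⁰` (so `(Ker φ)⁰` is the largest such subset and does not depend on the
choice made in its definition). [folklore] -/
theorem subset_kerComponentCarrier {Z : Set X.X.left} (hZ : IsPreirreducible Z) (h1 : origin X ∈ Z)
    (hZN : Z ⊆ kerSet φ) : Z ⊆ kerComponentCarrier φ :=
  subset_of_isPreirreducible_of_origin_mem (isClosed_kerSet φ) (mul_left_closedPoint_mem_kerSet φ)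
    (kerComponentCarrier φ) (isIrreducible_kerComponentCarrier φ) (origin_mem_kerComponentCarrier φ)
    (kerComponentCarrier_subset_kerSet φ) (kerComponentCarrier_maximal φ) hZ h1 hZN

/-- Characterisation of `(Ker φ)⁰` independent of choices: a closed irreducible subset of `φ⁻¹(e)`
containing the origin and maximal among the irreducible subsets of `φ⁻¹(e)` is `(Ker φ)⁰`.
[folklore] -/
theorem eq_kerComponentCarrier {C : Set X.X.left} (hC : IsPreirreducible C) (h1 : origin X ∈ C)
    (hCN : C ⊆ kerSet φ)
    (hmax : ∀ Z : Set X.X.left, IsPreirreducible Z → C ⊆ Z → Z ⊆ kerSet φ → Z = C) :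
    C = kerComponentCarrier φ :=
  (hmax _ (isIrreducible_kerComponentCarrier φ).isPreirreducible (subset_kerComponentCarrier φ hC h1 hCN)
    (kerComponentCarrier_subset_kerSet φ)).symm

/-- **The kernel set is a finite union of translates of the identity component** by `K`-points of
the kernel. [folklore] -/
theorem kerSet_subset_iUnion_translation_kerComponentCarrier :
    ∃ (I : Type u) (_ : Finite I) (Q : I → X.Points K),
      (∀ i, (Q i).left (IsLocalRing.closedPoint K) ∈ kerSet φ) ∧
      kerSet φ ⊆ ⋃ i, (X.translation (Q i)).left '' (kerComponentCarrier φ : Set X.X.left) :=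
  exists_finite_subset_iUnion_translation (isClosed_kerSet φ) (mul_left_closedPoint_mem_kerSet φ)
    (inv_left_closedPoint_mem_kerSet φ) (kerComponentCarrier φ) (isIrreducible_kerComponentCarrier φ)
    (origin_mem_kerComponentCarrier φ) (kerComponentCarrier_subset_kerSet φ)
    (kerComponentCarrier_maximal φ)

/-- `(Ker φ)⁰` is stable under the difference morphism `(x, y) ↦ x y⁻¹`: the hypothesis `hδ` of
`redSub`. [folklore] -/
theorem range_divMor_subset_kerComponentCarrier :
    Set.range ((redSubι (kerComponentCarrier φ) ⊗ₘ redSubι (kerComponentCarrier φ)) ≫ divMor X).left ⊆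
      kerComponentCarrier φ :=
  range_divMor_subset_of_maximal φ (kerComponentCarrier φ) (isIrreducible_kerComponentCarrier φ)
    (origin_mem_kerComponentCarrier φ) (kerComponentCarrier_subset_kerSet φ)
    (kerComponentCarrier_maximal φ)

end KerComponentCarrier

/-! ### `(Ker φ)⁰` is the connected component of the origin in `φ⁻¹(e)` -/

section ConnectedComponent

variable [IsAlgClosed K] {X Y : AbelianVariety K} (φ : X ⟶ Y)

omit [IsAlgClosed K] in
/-- The point of the unit `K`-point is the origin. [folklore] -/
theorem pt_one_eq_origin (X : AbelianVariety K) : AlgPoints.pt (1 : X.Points K) = origin X := by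
  change (1 : X.Points K).left (IsLocalRing.closedPoint K) = origin X
  rw [one_left]
  change (unitPt X) ((specOver K K).hom (IsLocalRing.closedPoint K)) = origin X
  rw [eq_specPt K ((specOver K K).hom (IsLocalRing.closedPoint K))]

omit [IsAlgClosed K] in
/-- The point of `Q` is `t_Q(e)`. [folklore] -/
theorem translation_apply_origin (Q : X.Points K) :
    (X.translation Q).left (origin X) = AlgPoints.pt Q := by
  rw [← pt_one_eq_origin, translation_apply_pt, mul_one]

omit [IsAlgClosed K] in
/-- `t_{Q⁻¹}(t_Q(x)) = x`. [folklore] -/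
theorem translation_inv_apply_translation_apply (Q : X.Points K) (x : X.X.left) :
    (X.translation Q⁻¹).left ((X.translation Q).left x) = x := by
  rw [← Scheme.Hom.comp_apply]
  change (X.translation Q ≫ X.translation Q⁻¹).left x = x
  rw [translation_comp_translation_inv]
  rfl

omit [IsAlgClosed K] in
/-- `t_Q(t_{Q⁻¹}(x)) = x`. [folklore] -/
theorem translation_apply_translation_inv_apply (Q : X.Points K) (x : X.X.left) :
    (X.translation Q).left ((X.translation Q⁻¹).left x) = x := by
  rw [← Scheme.Hom.comp_apply]
  change (X.translation Q⁻¹ ≫ X.translation Q).left x = x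
  rw [translation_inv_comp_translation]
  rfl

omit [IsAlgClosed K] in
/-- `t_{R S}(x) = t_R(t_S(x))`. [folklore] -/
theorem translation_mul_apply (R S : X.Points K) (x : X.X.left) :
    (X.translation (R * S)).left x = (X.translation R).left ((X.translation S).left x) := by
  rw [← Scheme.Hom.comp_apply]
  change _ = (X.translation S ≫ X.translation R).left x
  rw [translation_comp]

omit [IsAlgClosed K] in
/-- Translates of closed sets are closed (translations are isomorphisms). [folklore] -/
theorem isClosed_image_translation (Q : X.Points K) {C : Set X.X.left} (hC : IsClosed C) :
    IsClosed ((X.translation Q).left '' C) := by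
  have e : (X.translation Q).left '' C = (X.translation Q⁻¹).left ⁻¹' C := by
    ext x
    constructor
    · rintro ⟨c, hc, rfl⟩
      change (X.translation Q⁻¹).left ((X.translation Q).left c) ∈ C
      rw [translation_inv_apply_translation_apply]
      exact hc
    · intro hx
      exact ⟨_, hx, translation_apply_translation_inv_apply Q x⟩
  rw [e]
  exact hC.preimage (X.translation Q⁻¹).left.continuous

/-- Translations by `K`-points of the kernel preserve the kernel set. [folklore] -/
theorem translation_apply_mem_kerSet (Q : X.Points K)
    (hQ : Q.left (IsLocalRing.closedPoint K) ∈ kerSet φ) {x : X.X.left} (hx : x ∈ kerSet φ) :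
    (X.translation Q).left x ∈ kerSet φ :=
  translation_apply_mem (isClosed_kerSet φ) (mul_left_closedPoint_mem_kerSet φ) Q hQ hx

/-- **`(Ker φ)⁰` is stable under translation by the inverses of its `K`-points** (uniqueness:
`t_{Q⁻¹}((Ker φ)⁰)` is irreducible, lies in `φ⁻¹(e)` and contains `e = t_{Q⁻¹}(Q)`). [folklore] -/
theorem image_translation_inv_subset_kerComponentCarrier (Q : X.Points K)
    (hQ : AlgPoints.pt Q ∈ (kerComponentCarrier φ : Set X.X.left)) :
    (X.translation Q⁻¹).left '' (kerComponentCarrier φ : Set X.X.left) ⊆ kerComponentCarrier φ := by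
  have hQN : Q.left (IsLocalRing.closedPoint K) ∈ kerSet φ := kerComponentCarrier_subset_kerSet φ hQ
  have hQ'N := inv_left_closedPoint_mem_kerSet φ Q hQN
  refine subset_kerComponentCarrier φ ?_ ?_ ?_
  · exact ((isIrreducible_kerComponentCarrier φ).image _
      (X.translation Q⁻¹).left.continuous.continuousOn).isPreirreducible
  · refine ⟨AlgPoints.pt Q, hQ, ?_⟩
    rw [translation_apply_pt, inv_mul_cancel, pt_one_eq_origin]
  · rintro _ ⟨x, hx, rfl⟩
    exact translation_apply_mem_kerSet φ Q⁻¹ hQ'N (kerComponentCarrier_subset_kerSet φ hx)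

/-- The `K`-points of `(Ker φ)⁰` are closed under inverses. [folklore] -/
theorem pt_inv_mem_kerComponentCarrier (Q : X.Points K)
    (hQ : AlgPoints.pt Q ∈ (kerComponentCarrier φ : Set X.X.left)) :
    AlgPoints.pt Q⁻¹ ∈ (kerComponentCarrier φ : Set X.X.left) :=
  image_translation_inv_subset_kerComponentCarrier φ Q hQ
    ⟨origin X, origin_mem_kerComponentCarrier φ, translation_apply_origin Q⁻¹⟩

/-- **Translations by `K`-points of `(Ker φ)⁰` preserve `(Ker φ)⁰`.** [folklore] -/
theorem image_translation_kerComponentCarrier (Q : X.Points K)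
    (hQ : AlgPoints.pt Q ∈ (kerComponentCarrier φ : Set X.X.left)) :
    (X.translation Q).left '' (kerComponentCarrier φ : Set X.X.left) = kerComponentCarrier φ := by
  apply Set.Subset.antisymm
  · have h := image_translation_inv_subset_kerComponentCarrier φ Q⁻¹ (pt_inv_mem_kerComponentCarrier φ Q hQ)
    rwa [inv_inv] at h
  · intro x hx
    exact ⟨(X.translation Q⁻¹).left x,
      image_translation_inv_subset_kerComponentCarrier φ Q hQ ⟨x, hx, rfl⟩,
      translation_apply_translation_inv_apply Q x⟩

/-- **Dichotomy for translates of `(Ker φ)⁰`**: a translate `t_Q((Ker φ)⁰)` meeting `(Ker φ)⁰` equals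
it (a closed point `c = R` of the closed set `t_Q((Ker φ)⁰) ∩ (Ker φ)⁰` is rational, `K = K̄`;
`S = Q⁻¹ R` and `R` are `K`-points of `(Ker φ)⁰`, and `t_Q = t_R ∘ t_{S⁻¹}`). [folklore] -/
theorem image_translation_kerComponentCarrier_of_nonempty (Q : X.Points K)
    (h : ((X.translation Q).left '' (kerComponentCarrier φ : Set X.X.left) ∩
      (kerComponentCarrier φ : Set X.X.left)).Nonempty) :
    (X.translation Q).left '' (kerComponentCarrier φ : Set X.X.left) = kerComponentCarrier φ := by
  set C := (kerComponentCarrier φ : Set X.X.left) with hCdef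
  have hcl : IsClosed ((X.translation Q).left '' C ∩ C) :=
    (isClosed_image_translation Q (kerComponentCarrier φ).isClosed).inter (kerComponentCarrier φ).isClosed
  obtain ⟨c, ⟨hcT, hcC⟩, hc⟩ := hcl.exists_closed_singleton h
  let R : X.Points K := X.pointOfClosed c hc
  have hRc : AlgPoints.pt R = c := X.pt_pointOfClosed c hc
  have hR : AlgPoints.pt R ∈ C := by rw [hRc]; exact hcC
  -- `S = Q⁻¹ R` has its point `t_{Q⁻¹}(c)` in `C`
  let S : X.Points K := Q⁻¹ * R
  have hS : AlgPoints.pt S ∈ C := by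
    obtain ⟨c₁, hc₁, hc₁c⟩ := hcT
    have e : AlgPoints.pt S = c₁ := by
      rw [← translation_apply_pt, hRc, ← hc₁c, translation_inv_apply_translation_apply]
    rw [e]; exact hc₁
  -- `Q = R S⁻¹`
  have hQ : Q = R * S⁻¹ := by
    simp only [S, mul_inv_rev, inv_inv, mul_inv_cancel_left]
  rw [hQ]
  have e1 : (X.translation (R * S⁻¹)).left '' C = (X.translation R).left '' ((X.translation S⁻¹).left '' C) := by
    rw [Set.image_image]
    refine Set.image_congr fun x _ => ?_
    exact translation_mul_apply R S⁻¹ x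
  rw [e1, image_translation_kerComponentCarrier φ S⁻¹ (pt_inv_mem_kerComponentCarrier φ S hS),
    image_translation_kerComponentCarrier φ R hR]

/-- **The complement of `(Ker φ)⁰` in `φ⁻¹(e)` is closed**: it is the union of the finitely many
translates `t_{Qᵢ}((Ker φ)⁰) ≠ (Ker φ)⁰` covering `φ⁻¹(e)`, each disjoint from `(Ker φ)⁰`. [folklore] -/
theorem isClosed_kerSet_diff_kerComponentCarrier :
    IsClosed (kerSet φ \ (kerComponentCarrier φ : Set X.X.left)) := by
  obtain ⟨I, hI, Q, -, hcover⟩ := kerSet_subset_iUnion_translation_kerComponentCarrier φ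
  set C := (kerComponentCarrier φ : Set X.X.left) with hCdef
  set J : Set I := {i | (X.translation (Q i)).left '' C ≠ C} with hJ
  have key : kerSet φ \ C = kerSet φ ∩ ⋃ i ∈ J, (X.translation (Q i)).left '' C := by
    ext z
    constructor
    · rintro ⟨hzN, hzC⟩
      obtain ⟨i, hi⟩ := Set.mem_iUnion.1 (hcover hzN)
      exact ⟨hzN, Set.mem_iUnion₂.2 ⟨i, fun heq => hzC (heq ▸ hi), hi⟩⟩
    · rintro ⟨hzN, hz⟩
      obtain ⟨i, hi, hzi⟩ := Set.mem_iUnion₂.1 hz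
      exact ⟨hzN, fun hzC =>
        hi (image_translation_kerComponentCarrier_of_nonempty φ (Q i) ⟨z, hzi, hzC⟩)⟩
  rw [key]
  exact (isClosed_kerSet φ).inter ((Set.toFinite J).isClosed_biUnion fun i _ =>
    isClosed_image_translation (Q i) (kerComponentCarrier φ).isClosed)

/-- `(Ker φ)⁰` is open in `φ⁻¹(e)`. [folklore] -/
theorem isOpen_preimage_kerComponentCarrier :
    IsOpen (((↑) : kerSet φ → X.X.left) ⁻¹' (kerComponentCarrier φ : Set X.X.left)) := by
  rw [← isClosed_compl_iff]
  have e : (((↑) : kerSet φ → X.X.left) ⁻¹' (kerComponentCarrier φ : Set X.X.left))ᶜ =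
      ((↑) : kerSet φ → X.X.left) ⁻¹' (kerSet φ \ (kerComponentCarrier φ : Set X.X.left)) := by
    ext ⟨w, hw⟩
    simp
  rw [e]
  exact (isClosed_kerSet_diff_kerComponentCarrier φ).preimage continuous_subtype_val

/-- **`(Ker φ)⁰` is the connected component of the origin in the kernel `φ⁻¹(e)`** (it is
irreducible, hence connected, and open and closed in `φ⁻¹(e)`): the identity component `G⁰` of
the group scheme `G = Ker φ` in the sense of Görtz–Wedhorn II, Def. 27.12 (as a set), which is
irreducible (Prop. 27.12 (1), Lemma 27.13). [cite: GortzWedhorn2023, Def./Prop. 27.12 and Lemma 27.13 (p. 608)] -/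
theorem connectedComponentIn_kerSet_origin :
    connectedComponentIn (kerSet φ) (origin X) = (kerComponentCarrier φ : Set X.X.left) := by
  apply Set.Subset.antisymm
  · rw [connectedComponentIn_eq_image (origin_mem_kerSet φ)]
    rintro _ ⟨z, hz, rfl⟩
    have hclopen : IsClopen (((↑) : kerSet φ → X.X.left) ⁻¹' (kerComponentCarrier φ : Set X.X.left)) :=
      ⟨(kerComponentCarrier φ).isClosed.preimage continuous_subtype_val,
        isOpen_preimage_kerComponentCarrier φ⟩
    exact hclopen.connectedComponent_subset (x := ⟨origin X, origin_mem_kerSet φ⟩)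
      (origin_mem_kerComponentCarrier φ) hz
  · exact (isIrreducible_kerComponentCarrier φ).isConnected.isPreconnected.subset_connectedComponentIn
      (origin_mem_kerComponentCarrier φ) (kerComponentCarrier_subset_kerSet φ)

end ConnectedComponent

/-! ### The identity component of the kernel as an abelian variety -/

section KerComponent

variable [IsAlgClosed K] {X Y : AbelianVariety K} (φ : X ⟶ Y)

/-- **The identity component `(Ker φ)⁰_red` of the kernel of a homomorphism `φ : X → Y` of abelian
varieties over an algebraically closed field, as an abelian variety**: the reduced closed subscheme of
`X` on `kerComponentCarrier φ` with the group law of `X` (Mumford, *Abelian Varieties*, §19, p. 173;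
Milne 1986, §12, proof of Prop. 12.1: "the reduced subscheme of the zero component of the kernel is
an abelian variety"). [cite: MumfordAV1970, §19 (p. 173)] -/
def kerComponent : AbelianVariety K :=
  redSub (kerComponentCarrier φ) (isIrreducible_kerComponentCarrier φ)
    (origin_mem_kerComponentCarrier φ) (range_divMor_subset_kerComponentCarrier φ)

/-- The inclusion `(Ker φ)⁰_red ↪ X`, a homomorphism of abelian varieties and a closed immersion.
[folklore] -/
def kerComponentι : kerComponent φ ⟶ X :=
  redSubHom (kerComponentCarrier φ) (isIrreducible_kerComponentCarrier φ)
    (origin_mem_kerComponentCarrier φ) (range_divMor_subset_kerComponentCarrier φ)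

/-- The underlying `K`-scheme of `(Ker φ)⁰_red` is the reduced closed subscheme on
`kerComponentCarrier φ`. [folklore] -/
theorem kerComponent_X : (kerComponent φ).X = redSubOver (kerComponentCarrier φ) := rfl

/-- On `K`-schemes, `kerComponentι` is the subscheme inclusion `redSubι`. [folklore] -/
theorem kerComponentι_hom : (kerComponentι φ).hom.hom.hom = redSubι (kerComponentCarrier φ) := rfl

/-- The unit of `(Ker φ)⁰_red` is the lifted unit `redSubOne`. [folklore] -/
theorem kerComponent_one :
    η[(kerComponent φ).X] = redSubOne (kerComponentCarrier φ) (origin_mem_kerComponentCarrier φ) := rfl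

/-- The multiplication of `(Ker φ)⁰_red` is the lifted multiplication `redSubMul`. [folklore] -/
theorem kerComponent_mul :
    μ[(kerComponent φ).X] = redSubMul (kerComponentCarrier φ) (isIrreducible_kerComponentCarrier φ)
      (origin_mem_kerComponentCarrier φ) (range_divMor_subset_kerComponentCarrier φ) := rfl

/-- On schemes, `kerComponentι` is Mathlib's inclusion of the reduced closed subscheme. [folklore] -/
theorem toSchemeHom_kerComponentι :
    Hom.toSchemeHom (kerComponentι φ) = (vanishingIdeal (kerComponentCarrier φ)).subschemeι := rfl

/-- `(Ker φ)⁰_red ↪ X` is a closed immersion. [folklore] -/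
instance isClosedImmersion_toSchemeHom_kerComponentι :
    IsClosedImmersion (Hom.toSchemeHom (kerComponentι φ)) :=
  (inferInstance : IsClosedImmersion (vanishingIdeal (kerComponentCarrier φ)).subschemeι)

/-- The image of `(Ker φ)⁰_red ↪ X` is `kerComponentCarrier φ`. [folklore] -/
theorem range_toSchemeHom_kerComponentι :
    Set.range (Hom.toSchemeHom (kerComponentι φ)) = (kerComponentCarrier φ : Set X.X.left) :=
  range_subschemeι_vanishingIdeal_eq _

/-- `(Ker φ)⁰_red ↪ X` is a monomorphism of abelian varieties. [folklore] -/
instance mono_kerComponentι : Mono (kerComponentι φ) :=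
  ⟨fun {Z} a b h => by
    apply Literature.AlgebraicGeometry.Motives.AbelianVariety.hom_ext
    exact (cancel_mono (redSubι (kerComponentCarrier φ))).1
      (congrArg (fun t : Z ⟶ X => t.hom.hom.hom) h)⟩

/-- **`(Ker φ)⁰_red` is killed by `φ`.** [folklore] -/
@[reassoc (attr := simp)]
theorem kerComponentι_comp : kerComponentι φ ≫ φ = 0 :=
  Literature.AlgebraicGeometry.Motives.AbelianVariety.hom_ext _ _
    (redSubι_comp_eq_one φ (kerComponentCarrier φ) (kerComponentCarrier_subset_kerSet φ))

/-- `φ` maps the points of `(Ker φ)⁰_red` to the origin. [folklore] -/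
theorem toSchemeHom_comp_apply_eq_origin (z : (kerComponent φ).X.left) :
    Hom.toSchemeHom φ (Hom.toSchemeHom (kerComponentι φ) z) = origin Y := by
  refine toSchemeHom_apply_of_mem_kerComponentCarrier φ ?_
  have hz : Hom.toSchemeHom (kerComponentι φ) z ∈ Set.range (Hom.toSchemeHom (kerComponentι φ)) :=
    Set.mem_range_self z
  rw [range_toSchemeHom_kerComponentι] at hz
  exact hz

omit [IsAlgClosed K] in
/-- A homomorphism whose kernel set is all of `X` is zero (`X` is reduced, so `φ` factors through
the reduced origin `e : Spec K ↪ Y`). [folklore] -/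
theorem eq_zero_of_kerSet_eq_univ (h : kerSet φ = Set.univ) : φ = 0 := by
  haveI : IsReduced X.X.left := SchemeOver.isReduced_left X.X
  have hk : (unitPt Y).ker ≤ (Hom.toSchemeHom φ).ker :=
    Scheme.Hom.ker_le_ker_of_range_subset_closure _ _ (by
      rw [range_unitPt, (isClosed_singleton_origin Y).closure_eq]
      rintro _ ⟨x, rfl⟩
      exact (mem_kerSet_iff φ).1 (h ▸ Set.mem_univ x))
  set u := IsClosedImmersion.lift (unitPt Y) (Hom.toSchemeHom φ) hk with hu
  have hfac : u ≫ unitPt Y = Hom.toSchemeHom φ := IsClosedImmersion.lift_fac _ _ _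
  have hu' : u = X.X.hom := by
    have h2 := congrArg (· ≫ Y.X.hom) hfac
    simp only [Category.assoc, unitPt_comp_hom, Category.comp_id, toSchemeHom_comp_hom] at h2
    exact h2
  apply Literature.AlgebraicGeometry.Motives.AbelianVariety.hom_ext
  apply Over.OverMorphism.ext
  change Hom.toSchemeHom φ = (1 : X.X ⟶ Y.X).left
  rw [one_left, ← hu', hfac]

/-- `dim (Ker φ)⁰_red < dim X` for `φ ≠ 0`. [folklore] -/
theorem dim_kerComponent_lt (hφ : φ ≠ 0) : (kerComponent φ).dim < X.dim :=
  dim_redSub_lt _ _ _ _ fun hC => hφ (eq_zero_of_kerSet_eq_univ φ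
    (Set.eq_univ_of_univ_subset (hC ▸ kerComponentCarrier_subset_kerSet φ)))

/-! ### The universal property among abelian varieties -/

variable {φ} {Z : AbelianVariety K} (h : Z ⟶ X) (hh : h ≫ φ = 0)

omit [IsAlgClosed K] in
include hh in
/-- A homomorphism `h : Z → X` killed by `φ` has image in the kernel set. [folklore] -/
theorem range_toSchemeHom_subset_kerSet : Set.range (Hom.toSchemeHom h) ⊆ kerSet φ := by
  rintro _ ⟨z, rfl⟩
  rw [mem_kerSet_iff, ← Scheme.Hom.comp_apply]
  have e : Hom.toSchemeHom h ≫ Hom.toSchemeHom φ = Hom.toSchemeHom (h ≫ φ) := rfl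
  rw [e, hh]
  exact range_one_left_subset Y Z.X ⟨z, rfl⟩

include hh in
/-- A homomorphism `h : Z → X` from an abelian variety killed by `φ` has image in `(Ker φ)⁰`
(irreducible, through the origin, inside `φ⁻¹(e)`). [folklore] -/
theorem range_toSchemeHom_subset_kerComponentCarrier :
    Set.range (Hom.toSchemeHom h) ⊆ kerComponentCarrier φ := by
  haveI := irreducibleSpace_left Z
  refine subset_kerComponentCarrier φ ?_ ⟨origin Z, toSchemeHom_origin h⟩
    (range_toSchemeHom_subset_kerSet h hh)
  rw [← Set.image_univ]
  exact ((IrreducibleSpace.isIrreducible_univ _).image _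
    (Hom.toSchemeHom h).continuous.continuousOn).isPreirreducible

/-- The factorisation of `h` through `(Ker φ)⁰_red ↪ X`, on underlying schemes (`Z` is reduced and
`h(Z) ⊆ (Ker φ)⁰`). [folklore] -/
def kerComponentLiftLeft : Z.X.left ⟶ (redSubOver (kerComponentCarrier φ)).left :=
  haveI : IsReduced Z.X.left := SchemeOver.isReduced_left Z.X
  IsClosedImmersion.lift (redSubι (kerComponentCarrier φ)).left (Hom.toSchemeHom h)
    (ker_redSubι_le_ker _ _ (range_toSchemeHom_subset_kerComponentCarrier h hh))

/-- The factorisation followed by the inclusion is `h`, on schemes. [folklore] -/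
@[reassoc (attr := simp)]
theorem kerComponentLiftLeft_ι :
    kerComponentLiftLeft h hh ≫ (redSubι (kerComponentCarrier φ)).left = Hom.toSchemeHom h :=
  haveI : IsReduced Z.X.left := SchemeOver.isReduced_left Z.X
  IsClosedImmersion.lift_fac _ _ _

/-- The factorisation of `h` through `(Ker φ)⁰_red`, as a `K`-morphism. [folklore] -/
def kerComponentLiftOver : Z.X ⟶ redSubOver (kerComponentCarrier φ) :=
  Over.homMk (kerComponentLiftLeft h hh) (by
    change kerComponentLiftLeft h hh ≫ (redSubι (kerComponentCarrier φ)).left ≫ X.X.hom = Z.X.hom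
    rw [kerComponentLiftLeft_ι_assoc]
    exact Over.w h.hom.hom.hom)

/-- The factorisation followed by the inclusion is `h`, as `K`-morphisms. [folklore] -/
@[reassoc (attr := simp)]
theorem kerComponentLiftOver_ι :
    kerComponentLiftOver h hh ≫ redSubι (kerComponentCarrier φ) = h.hom.hom.hom := by
  ext1; exact kerComponentLiftLeft_ι h hh

/-- The factorisation respects units. [folklore] -/
theorem one_kerComponentLiftOver : η[Z.X] ≫ kerComponentLiftOver h hh = η[(kerComponent φ).X] := by
  rw [kerComponent_one, ← cancel_mono (redSubι (kerComponentCarrier φ)), Category.assoc,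
    kerComponentLiftOver_ι, IsMonHom.one_hom, redSubOne_ι]

/-- The factorisation respects multiplication. [folklore] -/
theorem mul_kerComponentLiftOver :
    μ[Z.X] ≫ kerComponentLiftOver h hh =
      (kerComponentLiftOver h hh ⊗ₘ kerComponentLiftOver h hh) ≫ μ[(kerComponent φ).X] := by
  change μ[Z.X] ≫ kerComponentLiftOver h hh =
      (kerComponentLiftOver h hh ⊗ₘ kerComponentLiftOver h hh) ≫
        redSubMul (kerComponentCarrier φ) (isIrreducible_kerComponentCarrier φ)
          (origin_mem_kerComponentCarrier φ) (range_divMor_subset_kerComponentCarrier φ)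
  rw [← cancel_mono (redSubι (kerComponentCarrier φ)), Category.assoc, kerComponentLiftOver_ι,
    IsMonHom.mul_hom, Category.assoc, redSubMul_ι, tensorHom_comp_tensorHom_assoc,
    kerComponentLiftOver_ι]

/-- **Universal property of `(Ker φ)⁰_red` among abelian varieties**: a homomorphism `h : Z → X`
from an abelian variety with `h ≫ φ = 0` factors through `(Ker φ)⁰_red ↪ X`. [folklore] -/
def kerComponentLift : Z ⟶ kerComponent φ :=
  InducedCategory.homMk (Grp.homMk'' (A := Z.toGrp) (B := (kerComponent φ).toGrp)
    (kerComponentLiftOver h hh) (one_kerComponentLiftOver h hh) (mul_kerComponentLiftOver h hh))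

/-- The factorisation followed by the inclusion is `h`. [folklore] -/
@[reassoc (attr := simp)]
theorem kerComponentLift_ι : kerComponentLift h hh ≫ kerComponentι φ = h :=
  Literature.AlgebraicGeometry.Motives.AbelianVariety.hom_ext _ _ (kerComponentLiftOver_ι h hh)

/-- The factorisation through `(Ker φ)⁰_red ↪ X` is unique. [folklore] -/
theorem kerComponentLift_unique (l : Z ⟶ kerComponent φ) (hl : l ≫ kerComponentι φ = h) :
    l = kerComponentLift h hh := by
  rw [← cancel_mono (kerComponentι φ), hl, kerComponentLift_ι]

variable (φ)

/-- **Endomorphisms commuting with `φ` restrict to `(Ker φ)⁰_red`**: if `u ≫ φ = φ ≫ v` for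
endomorphisms `u` of `X` and `v` of `Y`, then `u` maps `(Ker φ)⁰_red` into itself. For `φ` the norm
map of a cover of curves this is how correspondences compatible with the norm act on the Prym
variety. [folklore] -/
def kerComponentRestrict (u : X ⟶ X) (v : Y ⟶ Y) (huv : u ≫ φ = φ ≫ v) :
    kerComponent φ ⟶ kerComponent φ :=
  kerComponentLift (kerComponentι φ ≫ u) (by rw [Category.assoc, huv, kerComponentι_comp_assoc, zero_comp])

/-- The restriction is compatible with the inclusion. [folklore] -/
@[reassoc (attr := simp)]
theorem kerComponentRestrict_ι (u : X ⟶ X) (v : Y ⟶ Y) (huv : u ≫ φ = φ ≫ v) :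
    kerComponentRestrict φ u v huv ≫ kerComponentι φ = kerComponentι φ ≫ u :=
  kerComponentLift_ι _ _

/-- Restriction of the identity is the identity. [folklore] -/
@[simp]
theorem kerComponentRestrict_id : kerComponentRestrict φ (𝟙 X) (𝟙 Y) (by simp) = 𝟙 _ := by
  rw [← cancel_mono (kerComponentι φ), kerComponentRestrict_ι, Category.id_comp, Category.comp_id]

/-- Restriction is multiplicative. [folklore] -/
theorem kerComponentRestrict_comp (u u' : X ⟶ X) (v v' : Y ⟶ Y) (huv : u ≫ φ = φ ≫ v)
    (huv' : u' ≫ φ = φ ≫ v') :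
    kerComponentRestrict φ (u ≫ u') (v ≫ v')
        (by rw [Category.assoc, huv', ← Category.assoc, huv, Category.assoc]) =
      kerComponentRestrict φ u v huv ≫ kerComponentRestrict φ u' v' huv' := by
  rw [← cancel_mono (kerComponentι φ), kerComponentRestrict_ι, Category.assoc,
    kerComponentRestrict_ι, kerComponentRestrict_ι_assoc]

/-- Restriction is additive. [folklore] -/
theorem kerComponentRestrict_add (u u' : X ⟶ X) (v v' : Y ⟶ Y) (huv : u ≫ φ = φ ≫ v)
    (huv' : u' ≫ φ = φ ≫ v') :
    kerComponentRestrict φ (u + u') (v + v') (by rw [Preadditive.add_comp, Preadditive.comp_add, huv, huv']) =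
      kerComponentRestrict φ u v huv + kerComponentRestrict φ u' v' huv' := by
  rw [← cancel_mono (kerComponentι φ), kerComponentRestrict_ι, Preadditive.add_comp,
    kerComponentRestrict_ι, kerComponentRestrict_ι, Preadditive.comp_add]

end KerComponent

/-! ### Dimension: `dim X = dim Y + dim (Ker φ)⁰` for `φ` surjective -/

section Dimension

variable [IsAlgClosed K] {X Y : AbelianVariety K} (φ : X ⟶ Y)

/-- **Every chain of specialisations in `φ⁻¹(e)` lies in a translate of `(Ker φ)⁰`**, so
`dim φ⁻¹(e) ≤ dim (Ker φ)⁰`: the closure of the top of the chain is irreducible, lies in `φ⁻¹(e)`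
and has a closed (hence rational, `K = K̄`) point `Q`, so it lies in `t_Q((Ker φ)⁰)`
(`subset_image_translation_of_isPreirreducible`), and the translation `t_Q` is a homeomorphism.
[folklore] -/
theorem topologicalKrullDim_kerSet_le :
    topologicalKrullDim (kerSet φ) ≤
      topologicalKrullDim (kerComponentCarrier φ : Set X.X.left) := by
  have hN := isClosed_kerSet φ
  haveI := Literature.Topology.quasiSober_of_isClosed hN
  haveI := Literature.Topology.quasiSober_of_isClosed (kerComponentCarrier φ).isClosed
  -- the specialisation orders (`x ≤ y ↔ y ⤳ x`), as local instances overriding the subspace orders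
  letI i₁ : Preorder (kerSet φ) := (specializationOrder (kerSet φ)).toPreorder
  letI i₂ : Preorder (kerComponentCarrier φ : Set X.X.left) :=
    (specializationOrder (kerComponentCarrier φ : Set X.X.left)).toPreorder
  rw [Literature.Topology.topologicalKrullDim_eq_krullDim,
    Literature.Topology.topologicalKrullDim_eq_krullDim]
  unfold Order.krullDim
  refine iSup_le fun l => ?_
  -- the top of the chain, its closure `T ⊆ φ⁻¹(e)`, a closed point `c ∈ T` and its rational point `Q`
  set z : X.X.left := (l.last).1 with hz
  have hzN : z ∈ kerSet φ := (l.last).2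
  have hTN : closure {z} ⊆ kerSet φ := closure_minimal (Set.singleton_subset_iff.2 hzN) hN
  have hTirr : IsPreirreducible (closure ({z} : Set X.X.left)) := isPreirreducible_singleton.closure
  obtain ⟨c, hcT, hc⟩ := (isClosed_closure (s := ({z} : Set X.X.left))).exists_closed_singleton
    ⟨z, subset_closure rfl⟩
  let Q : X.Points K := X.pointOfClosed c hc
  have hQc : Q.left (IsLocalRing.closedPoint K) = c := X.pt_pointOfClosed c hc
  -- `T ⊆ t_Q((Ker φ)⁰)`
  have hTC : closure {z} ⊆ (X.translation Q).left '' (kerComponentCarrier φ : Set X.X.left) :=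
    subset_image_translation_of_isPreirreducible hN (mul_left_closedPoint_mem_kerSet φ)
      (inv_left_closedPoint_mem_kerSet φ) (kerComponentCarrier φ) (isIrreducible_kerComponentCarrier φ)
      (origin_mem_kerComponentCarrier φ) (kerComponentCarrier_subset_kerSet φ)
      (kerComponentCarrier_maximal φ) hTirr hTN Q (by rw [hQc]; exact hcT)
  -- every member of the chain is a specialisation of `z`, hence lies in `T`
  have hlT : ∀ i, (l i).1 ∈ closure ({z} : Set X.X.left) := fun i => by
    have hsp : l.last ⤳ l i := l.monotone (Fin.le_last i)
    exact ((subtype_specializes_iff _ _).1 hsp).mem_closed isClosed_closure (subset_closure rfl)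
  -- pull the chain back along the translation, an embedding
  set t := (X.translation Q).left with ht
  have htind : IsInducing t := t.isOpenEmbedding.isInducing
  have key : ∀ i, ∃ c' : X.X.left, c' ∈ (kerComponentCarrier φ : Set X.X.left) ∧ t c' = (l i).1 :=
    fun i => hTC (hlT i)
  choose g hgC hgt using key
  -- specialisations among the `g i` are those among the `l i`
  have hiff : ∀ i j, g i ⤳ g j ↔ l i ⤳ l j := fun i j => by
    rw [subtype_specializes_iff, ← htind.specializes_iff, hgt, hgt]
  let f : Fin (l.length + 1) → (kerComponentCarrier φ : Set X.X.left) := fun i => ⟨g i, hgC i⟩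
  have hf : StrictMono f := fun a b hab => by
    have hlt : l b ⤳ l a ∧ ¬ l a ⤳ l b := l.strictMono hab
    change (f b ⤳ f a) ∧ ¬ (f a ⤳ f b)
    rw [subtype_specializes_iff, subtype_specializes_iff]
    change (g b ⤳ g a) ∧ ¬ (g a ⤳ g b)
    rw [hiff, hiff]
    exact hlt
  exact le_iSup_of_le (LTSeries.mk l.length f hf) le_rfl

omit [IsAlgClosed K] in
/-- `dim (Ker φ)⁰ ≤ dim φ⁻¹(e)` (a subspace). [folklore] -/
theorem topologicalKrullDim_kerComponentCarrier_le :
    topologicalKrullDim (kerComponentCarrier φ : Set X.X.left) ≤ topologicalKrullDim (kerSet φ) :=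
  (IsEmbedding.inclusion (kerComponentCarrier_subset_kerSet φ)).isInducing.topologicalKrullDim_le

omit [IsAlgClosed K] in
/-- The scheme-theoretic kernel `Ker φ` and the kernel set `φ⁻¹(e) ⊆ X` have the same dimension
(`Ker φ → X` is a closed immersion with image `φ⁻¹(e)`). [folklore] -/
theorem topologicalKrullDim_ker_eq_kerSet :
    topologicalKrullDim ↥(Hom.ker φ) = topologicalKrullDim (kerSet φ) := by
  haveI : IsClosedImmersion (Hom.kerι φ) := MorphismProperty.pullback_fst _ _ inferInstance
  have e := (Hom.kerι φ).isClosedEmbedding.isEmbedding.toHomeomorph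
  rw [IsHomeomorph.topologicalKrullDim_eq _ e.isHomeomorph]
  exact IsHomeomorph.topologicalKrullDim_eq _ (Homeomorph.setCongr (kerSet_eq_range_kerι φ).symm).isHomeomorph

/-- The underlying space of `(Ker φ)⁰_red` is homeomorphic to `(Ker φ)⁰ ⊆ X`, so
`dim (Ker φ)⁰_red = dim (Ker φ)⁰`. [folklore] -/
theorem topologicalKrullDim_kerComponentCarrier :
    topologicalKrullDim (kerComponentCarrier φ : Set X.X.left) = (kerComponent φ).dim := by
  rw [← topologicalKrullDim_left (kerComponent φ)]
  have e := (Hom.toSchemeHom (kerComponentι φ)).isClosedEmbedding.isEmbedding.toHomeomorph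
  rw [IsHomeomorph.topologicalKrullDim_eq _ e.isHomeomorph]
  exact (IsHomeomorph.topologicalKrullDim_eq _
    (Homeomorph.setCongr (range_toSchemeHom_kerComponentι φ)).isHomeomorph).symm

/-- `dim Ker φ = dim (Ker φ)⁰_red`: all components of the kernel are translates of the identity
component. [folklore] -/
theorem topologicalKrullDim_ker_eq_dim_kerComponent :
    topologicalKrullDim ↥(Hom.ker φ) = (kerComponent φ).dim := by
  rw [topologicalKrullDim_ker_eq_kerSet,
    le_antisymm (topologicalKrullDim_kerSet_le φ) (topologicalKrullDim_kerComponentCarrier_le φ),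
    topologicalKrullDim_kerComponentCarrier]

/-- **Dimension formula: `dim X = dim Y + dim (Ker φ)⁰_red` for a surjective homomorphism
`φ : X ↠ Y`** (the dimension formula `dim X = dim Y + dim Ker φ` of
`Motives/AbelianVarietyKernelDimension`, Görtz–Wedhorn II Prop. 27.176, and
`dim Ker φ = dim (Ker φ)⁰`). For `φ = Nm_f` this is `dim P(f) = g(C) − g(C')`
(Lange–Rodríguez eq. (3.6)) granted `dim J = g` and the surjectivity of the norm.
[cite: GortzWedhorn2023, Prop. 27.176] -/
theorem dim_eq_dim_add_dim_kerComponent [Surjective (Hom.toSchemeHom φ)] :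
    X.dim = Y.dim + (kerComponent φ).dim := by
  have hd := dim_eq_dim_add_topologicalKrullDim_ker φ
  rw [topologicalKrullDim_ker_eq_dim_kerComponent] at hd
  have hd' : ((X.dim : ℕ∞) : WithBot ℕ∞) = ((Y.dim + (kerComponent φ).dim : ℕ) : ℕ∞) := by
    rw [hd]; push_cast; rfl
  exact_mod_cast hd'

end Dimension

end AbelianVariety

/-! ### Prym varieties -/

section Prym

variable {K : Type u} [Field K] [IsAlgClosed K] {J J' : AbelianVariety K}

/-- **The Prym variety** `P = (Ker Nm)⁰` of a homomorphism `Nm : J → J'` of abelian varieties over an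
algebraically closed field, meant to be the norm map `Nm_f : J(C) → J(C')` of a finite cover
`f : C → C'` of smooth projective curves: the identity component of `Ker Nm` with its reduced
structure, as an abelian variety (`AbelianVariety.kerComponent`; its image in `J` is the connected
component of the origin in `Nm⁻¹(e)`, `PrymVariety.range_toSchemeHom_incl_eq_connectedComponentIn`).
For `Nm = Nm_f` this is the Prym variety `P(f) = Ker(Nm_f)⁰ ⊆ J(C)` of the cover (Lange–Rodríguez,
§3.2.1, eq. (3.5); equal to the complementary abelian subvariety of `f^* J(C')` in `J(C)` for the
canonical polarization, *loc. cit.*, which is the definition printed there; Lange 2023, §5.3.2; for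
étale double covers Mumford 1974). For a cover take `Nm := 𝒥.pushforward 𝒥' f`, the norm map
`Nm_f = f_*` of `Motives/Jacobian` (this is `PrymVariety.ofCover` of `Motives/PrymVarietyOfCover`);
`K` is algebraically closed (the consumers work over `ℂ`).
[cite: LangeRodriguez2022, §3.2.1 eq. (3.5)] -/
def PrymVariety (Nm : J ⟶ J') : AbelianVariety K := AbelianVariety.kerComponent Nm

namespace PrymVariety

variable (Nm : J ⟶ J')

/-- The Prym variety is the identity component of the kernel of the norm. [folklore] -/
theorem eq_kerComponent : PrymVariety Nm = AbelianVariety.kerComponent Nm := rfl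

/-- The inclusion `ι_P : P ↪ J` of the Prym variety, a homomorphism and a closed immersion
(Lange–Rodríguez §3.2.1: `P(f)` is an abelian subvariety of `J(C̃)`).
[cite: LangeRodriguez2022, §3.2.1 eq. (3.5)] -/
def incl : PrymVariety Nm ⟶ J := AbelianVariety.kerComponentι Nm

/-- `ι_P = incl` is a closed immersion. [folklore] -/
instance isClosedImmersion_toSchemeHom_incl : IsClosedImmersion (AbelianVariety.Hom.toSchemeHom (incl Nm)) :=
  AbelianVariety.isClosedImmersion_toSchemeHom_kerComponentι Nm

/-- `ι_P = incl` is a monomorphism. [folklore] -/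
instance mono_incl : Mono (incl Nm) := AbelianVariety.mono_kerComponentι Nm

/-- **The Prym variety lies in the kernel of the norm: `ι_P ≫ Nm = 0`.**
[cite: LangeRodriguez2022, §3.2.1 eq. (3.5)] -/
@[reassoc (attr := simp)]
theorem incl_comp_norm : incl Nm ≫ Nm = 0 := AbelianVariety.kerComponentι_comp Nm

/-- The image of `ι_P = incl` in `J` is the identity component `(Ker Nm)⁰` of the kernel set. [folklore] -/
theorem range_toSchemeHom_incl :
    Set.range (AbelianVariety.Hom.toSchemeHom (incl Nm)) =
      (AbelianVariety.kerComponentCarrier Nm : Set J.X.left) :=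
  AbelianVariety.range_toSchemeHom_kerComponentι Nm

/-- **`P = Ker(Nm)⁰`**: the image of `ι_P = incl` is the connected component of the origin in the
kernel `Nm⁻¹(e)` (Lange–Rodríguez, eq. (3.5) with Notations p. xi: `B⁰` is the connected component
of `B` containing `0`). [cite: LangeRodriguez2022, §3.2.1 eq. (3.5)] -/
theorem range_toSchemeHom_incl_eq_connectedComponentIn :
    Set.range (AbelianVariety.Hom.toSchemeHom (incl Nm)) =
      connectedComponentIn (AbelianVariety.kerSet Nm) (AbelianVariety.origin J) := by
  rw [range_toSchemeHom_incl, AbelianVariety.connectedComponentIn_kerSet_origin]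

/-- `dim P < dim J` when `Nm ≠ 0`. [folklore] -/
theorem dim_lt (hNm : Nm ≠ 0) : (PrymVariety Nm).dim < J.dim :=
  AbelianVariety.dim_kerComponent_lt Nm hNm

/-- **`dim J = dim J' + dim P` for a surjective norm** (all components of `Ker Nm` are translates of
`P`, and `dim J = dim J' + dim Ker Nm`). With `dim J(C) = g(C)`, `dim J(C') = g(C')` and `Nm_f`
surjective this is `dim P(f) = g(C) − g(C')` (Lange–Rodríguez, eq. (3.6)).
[cite: LangeRodriguez2022, §3.2.1 eq. (3.6)] -/
theorem dim_add_dim [Surjective (AbelianVariety.Hom.toSchemeHom Nm)] :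
    J'.dim + (PrymVariety Nm).dim = J.dim :=
  (AbelianVariety.dim_eq_dim_add_dim_kerComponent Nm).symm

/-- `dim P = dim J − dim J'` for a surjective norm (Lange–Rodríguez, eq. (3.6):
`dim P(f) = g̃ − g`). [cite: LangeRodriguez2022, §3.2.1 eq. (3.6)] -/
theorem dim_eq [Surjective (AbelianVariety.Hom.toSchemeHom Nm)] :
    (PrymVariety Nm).dim = J.dim - J'.dim := by
  have h := dim_add_dim Nm
  omega

variable {Nm} {Z : AbelianVariety K} (h : Z ⟶ J) (hh : h ≫ Nm = 0)

/-- **Universal property**: a homomorphism `h : Z → J` from an abelian variety with `h ≫ Nm = 0`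
factors through `ι_P = incl` (e.g. `1 - σ` for a double cover with involution `σ`, whose image is `P`).
[folklore] -/
def lift : Z ⟶ PrymVariety Nm := AbelianVariety.kerComponentLift h hh

/-- The factorisation followed by `ι_P = incl` is `h`. [folklore] -/
@[reassoc (attr := simp)]
theorem lift_incl : lift h hh ≫ incl Nm = h := AbelianVariety.kerComponentLift_ι h hh

/-- The factorisation through `ι_P = incl` is unique. [folklore] -/
theorem lift_unique (l : Z ⟶ PrymVariety Nm) (hl : l ≫ incl Nm = h) : l = lift h hh :=
  AbelianVariety.kerComponentLift_unique h hh l hl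

variable (Nm)

/-- **Endomorphisms of `J` compatible with the norm act on the Prym variety**: if
`u ≫ Nm = Nm ≫ v` then `u` restricts along `ι_P = incl` to an endomorphism of `P` (for an intermediate
cover `C̃/H → C̃/N` of a Galois cover, the Hecke double-coset correspondences on `J(C̃/H)`).
[folklore] -/
def restrict (u : J ⟶ J) (v : J' ⟶ J') (huv : u ≫ Nm = Nm ≫ v) : PrymVariety Nm ⟶ PrymVariety Nm :=
  AbelianVariety.kerComponentRestrict Nm u v huv

/-- The restriction is compatible with `ι_P = incl`. [folklore] -/
@[reassoc (attr := simp)]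
theorem restrict_incl (u : J ⟶ J) (v : J' ⟶ J') (huv : u ≫ Nm = Nm ≫ v) :
    restrict Nm u v huv ≫ incl Nm = incl Nm ≫ u :=
  AbelianVariety.kerComponentRestrict_ι Nm u v huv

/-- Restriction of the identity is the identity. [folklore] -/
@[simp]
theorem restrict_id : restrict Nm (𝟙 J) (𝟙 J') (by simp) = 𝟙 _ :=
  AbelianVariety.kerComponentRestrict_id Nm

/-- Restriction is multiplicative. [folklore] -/
theorem restrict_comp (u u' : J ⟶ J) (v v' : J' ⟶ J') (huv : u ≫ Nm = Nm ≫ v)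
    (huv' : u' ≫ Nm = Nm ≫ v') :
    restrict Nm (u ≫ u') (v ≫ v') (by rw [Category.assoc, huv', ← Category.assoc, huv, Category.assoc]) =
      restrict Nm u v huv ≫ restrict Nm u' v' huv' :=
  AbelianVariety.kerComponentRestrict_comp Nm u u' v v' huv huv'

/-- Restriction is additive. [folklore] -/
theorem restrict_add (u u' : J ⟶ J) (v v' : J' ⟶ J') (huv : u ≫ Nm = Nm ≫ v)
    (huv' : u' ≫ Nm = Nm ≫ v') :
    restrict Nm (u + u') (v + v') (by rw [Preadditive.add_comp, Preadditive.comp_add, huv, huv']) =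
      restrict Nm u v huv + restrict Nm u' v' huv' :=
  AbelianVariety.kerComponentRestrict_add Nm u u' v v' huv huv'

end PrymVariety

end Prym

end Literature.AlgebraicGeometry.Motives
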